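import Summits.ABC.IUTFork.Conditional.AbcOfSPerImageGenuine
import Summits.ABC.IUTFork.Conditional.AbcOfSGenuineSideVacuity
import Summits.ABC.IUTFork.Conditional.AbcOfSRealisingQObstruction
import HarnessLib

/-!
# Branch C, (P) per-image S-line AT THE GENUINE SETTING (`abc_of_S_perImage_genuine`, p432966): its SIDE class is
# UNSATISFIABLE AS TYPED — a kernel vacuity certificate (RQ7 second-reader probe)

PROOF-ONLY record (no `def`, no new `Prop`) of the abc-iut cell, seat abc-iut-w6-d110 (gen 2; block C / W6), written as the
KERNEL PROBE of an RQ7 second read of `Conditional/AbcOfSPerImageGenuine.lean` (abc-iut-S-d1, p432966) — the (P) per-image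
S-line OF RECORD at the genuine real setting (C-SCOREBOARD §1 «(P) PER-IMAGE LINES», C-R17). TAKES NO SIDE on [IUTchIII]
Cor. 3.12, on the reading (U)/(P) of `−|log(Θ)|`, or on any author; refutes neither S nor S_H nor S_HP.

THE POINT. `abc_of_S_perImage_genuine` concludes `ABC` from, per `λ`-line datum `(P, l, T)`, the classes S 1 · PIN 1 · READ 1 ·
SIDE 4 (`hX`, `htq0`, `htq1`, `htq`). Its SIDE class is the one of the (U)-line genuine certificates: `hX : IsPilotDataOf T.D (X P l T)`
ties the Dupuy–Hilado pilot data to the initial Θ-datum `T.D` OVER `T.D`'S FIELD `T.F`, and `htq` asks the q-ideles `tq P l T` in the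
completions of `T.F` to REALISE `P_q = ord_v(q_v)/(2l)`. abc-iut-C-cert-3's finding F1 (`SideVacuity.not_realising_qIdeles_of_isPilotDataOf`,
p432420: realising forces `2l ∣ ord_v(q_v)`, [IUTchI] Def. 3.1 (c) as typed forces `l ∤ ord_v(q_v)`) therefore applies VERBATIM:

* `PerImage.sideConditions_false` — per datum, the three binders `hX`, `htq0`, `htq` of `PerImage.cor312PerImageOf_of_S_genuine`
  (p432966 §1) are contradictory, for every `D`, `X`, `tq`;
* `abc_of_S_perImage_genuine_sideConditions_false` — at the apex: the family-level binders `X`, `tq`, `hX`, `htq0`, `htq` of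
  `abc_of_S_perImage_genuine` (p432966 §2; types copied byte for byte) yield `False`, by instantiating them at ONE admissible
  `λ`-line datum (`Conditional.exists_admissible_thetaVolumeDatum`, abc-iut-w5-d054 p432578 = `Cor22.exists_thm110Legendre_antecedent`
  + the PROVED child `ThetaPartII.stub_thetaData`).

CONSEQUENCE (for the C scoreboard / VERDICT §K, in kernel currency): the antecedent of `abc_of_S_perImage_genuine` is UNSATISFIABLE
AS TYPED — the (P)-line twin of abc-iut-w5-d054's `abc_of_S_v3_hypothesis_false` (p432578) for the (U)-line bundle `H`. The first
RQ7 record of p432966 (abc-iut-w5-d219, STATUS 08:47:42Z, I2) read the antecedent as «neither a kernel refutation nor a kernel witness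
⇒ OPEN»; with p432420 (landed 08:27Z) it is refuted — by the SIDE class alone, independently of S, the two pins and `hΘP`. As for
v3/v4/Shrink2/Shrink3 this is an artefact of OUR typing (F-level provenance `IsPilotDataOf` composed with `F_v`-level idele binders;
print works over `K = F(E_F[l])`, [IUTchI] Ex. 3.2 (iv)), C lead ruling C-R16; the repair of record is the `K`-level provenance
(R1, abc-iut-C-cert-3 v5) or idele-free radii (R2) — NOT executed here. The abstract per-image certificates `abc_of_S_perImage`
(p432418) and `abc_of_SHP` (p432622) carry no SIDE class and are NOT touched by this file.

HONEST FRAMING: locates / conditionally verifies; a statement about OUR typing only; nothing here asserts that abc is proved or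
refuted or bears on the truth of [IUTchIII] Cor. 3.12; typed ≠ proved; instantiated ≠ endorsed; audited ≠ endorsed.
[cite: Mochizuki2012, IUTchI Def. 3.1 (c) p. 61, Ex. 3.2 (iv) p. 71] [cite: DupuyHilado2025, §3.3, §3.4] [claim: Mochizuki2012, status: disputed]
-/

noncomputable section

open Set Function NumberField IsDedekindDomain

namespace Summit.ABC.IUTFork.Conditional

open Thm311 Thm311.Real Cor312 Cor312Vol Cor312Prov Literature.IUT.LogThetaLattice Literature.IUT.LogVolume
  Literature.IUT.HodgeTheaters Literature.IUT.LogVolume.ThetaData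

/-! ## §1. Per datum: the SIDE binders of `PerImage.cor312PerImageOf_of_S_genuine` are contradictory -/

section PerDatum

variable {F K Fbar : Type} [Field F] [NumberField F] [Field K] [NumberField K] [Algebra F K] [Field Fbar]
  [Algebra F Fbar] [Algebra K Fbar] {E : WeierstrassCurve F} [E.IsElliptic] {l : ℕ} {Pb : BadPlacePredicates K}
  (D : InitialThetaData F K Fbar E l Pb) (X : PilotData F)
  (tq : ∀ (pp : Nat.Primes) (x : (thetaIndex X).Fibre (.inr pp)), haveI : Fact (pp : ℕ).Prime := ⟨pp.2⟩; kOf X pp.1 x)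

/-- **Per datum, the SIDE class of the (P) per-image genuine line is empty.** The hypotheses `hX : IsPilotDataOf D X`,
`htq0` (q-ideles non-zero) and `htq` (q-ideles REALISE `P_q` in the completions of `F`) of `PerImage.cor312PerImageOf_of_S_genuine`
(abc-iut-S-d1, p432966 §1) hold for NO `D`, `X`, `tq` — abc-iut-C-cert-3's `SideVacuity.not_realising_qIdeles_of_isPilotDataOf`
(p432420): realising forces `2l ∣ ord_v(q_v)` on `S = 𝕍(F)^bad ≠ ∅`, Def. 3.1 (c) as typed forces `l ∤ ord_v(q_v)`. So that
theorem, correct as it stands, has an EMPTY antecedent at every genuine datum, whatever S, the pins and `hΘP` say. A statement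
about OUR typing; no side taken on [IUTchIII] Cor. 3.12. [cite: Mochizuki2012, IUTchI Def. 3.1 (c) p. 61, Ex. 3.2 (iv) p. 71] -/
theorem PerImage.sideConditions_false (hX : Cor312Prov.IsPilotDataOf D X) (htq0 : ∀ pp x, tq pp x ≠ 0)
    (htq : ∀ (pp : Nat.Primes) (x : (thetaIndex X).Fibre (.inr pp)),
      haveI : Fact (pp : ℕ).Prime := ⟨pp.2⟩
      Real.log ‖tq pp x‖ = -(X.qPilot (placeOf X pp.1 x)) * logNorm F (placeOf X pp.1 x) /
        localDegree F (placeOf X pp.1 x)) :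
    False :=
  SideVacuity.not_realising_qIdeles_of_isPilotDataOf D X hX tq htq0 htq

end PerDatum

/-! ## §2. At the apex: the family-level SIDE binders of `abc_of_S_perImage_genuine` yield `False` -/

section Family

open Literature.NumberTheory.DiophantineGeometry.GenEll Summit.ABC.ABC.Theorems

/-- **The antecedent of `abc_of_S_perImage_genuine` (p432966) is UNSATISFIABLE AS TYPED.** From its family-level binders
`X` (pilot data over `T.F` per datum), `tq` (q-ideles), `hX` (`X P l T` is the pilot data OF `T.D`), `htq0`, `htq` (the q-ideles
REALISE `P_q`) — types copied byte for byte from p432966 — `False` follows: instantiate at ONE admissible `λ`-line datum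
(`exists_admissible_thetaVolumeDatum`: abc-iut-w5-d054 p432578, from `Cor22.exists_thm110Legendre_antecedent` and the PROVED
`ThetaPartII.stub_thetaData`) and apply §1. Hence `abc_of_S_perImage_genuine : … → ABC` holds VACUOUSLY as typed — by its SIDE
class alone (S, the two pins, `htq1` and `hΘP` are not used). The (P)-line twin of `abc_of_S_v3_hypothesis_false` (p432578);
an artefact of F-level idele binders (C-R16), repair = `K`-level provenance (R1) or idele-free radii (R2), not executed here.
No side taken on [IUTchIII] Cor. 3.12, on (U)/(P), or on any author; typed ≠ proved.
[cite: Mochizuki2012, IUTchI Def. 3.1 (c) p. 61, Ex. 3.2 (iv) p. 71] [claim: Mochizuki2012, status: disputed] -/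
theorem abc_of_S_perImage_genuine_sideConditions_false
    (X : ∀ (P : NFPoint) (l : ℕ) (T : Cor22.ThetaVolumeDatumAt P l), @PilotData T.F T.instFieldF T.instNumberFieldF)
    (tq : ∀ (P : NFPoint) (l : ℕ) (T : Cor22.ThetaVolumeDatumAt P l), letI := T.instFieldF; letI := T.instNumberFieldF;
      ∀ (pp : Nat.Primes) (x : (thetaIndex (X P l T)).Fibre (.inr pp)), haveI : Fact (pp : ℕ).Prime := ⟨pp.2⟩; kOf (X P l T) pp.1 x)
    (hX : ∀ (P : NFPoint) (l : ℕ) (T : Cor22.ThetaVolumeDatumAt P l), letI := T.instFieldF; letI := T.instNumberFieldF; letI := T.instAlgebraF; letI := T.instFieldK;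
        letI := T.instNumberFieldK; letI := T.instAlgebraK; letI := T.instFieldFbar; letI := T.instAlgebraFbar;
        letI := T.instAlgebraKFbar; letI := T.instIsElliptic;
      Cor312Prov.IsPilotDataOf T.D (X P l T))
    (htq0 : ∀ P l T pp x, tq P l T pp x ≠ 0)
    (htq : ∀ (P : NFPoint) (l : ℕ) (T : Cor22.ThetaVolumeDatumAt P l), letI := T.instFieldF; letI := T.instNumberFieldF;
      ∀ (pp : Nat.Primes) (x : (thetaIndex (X P l T)).Fibre (.inr pp)),
        haveI : Fact (pp : ℕ).Prime := ⟨pp.2⟩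
        Real.log ‖tq P l T pp x‖ = -((X P l T).qPilot (placeOf (X P l T) pp.1 x)) * logNorm T.F (placeOf (X P l T) pp.1 x) /
          localDegree T.F (placeOf (X P l T) pp.1 x)) :
    False := by
  obtain ⟨P, l, -, -, -, -, -, -, -, ⟨T⟩⟩ := exists_admissible_thetaVolumeDatum
  letI := T.instFieldF; letI := T.instNumberFieldF; letI := T.instAlgebraF; letI := T.instFieldK
  letI := T.instNumberFieldK; letI := T.instAlgebraK; letI := T.instFieldFbar; letI := T.instAlgebraFbar
  letI := T.instAlgebraKFbar; letI := T.instIsElliptic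
  exact PerImage.sideConditions_false T.D (X P l T) (tq P l T) (hX P l T) (htq0 P l T) (htq P l T)

end Family

end Summit.ABC.IUTFork.Conditional

end
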